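import Literature.Computability.Complexity.Mod2PerfectMatchings
import Literature.Computability.Complexity.MatchingDerivations
import HarnessLib

/-!
# The affine hull of the perfect matchings of `K_n`: degree-one derivations
# (BBCHPRRWZ 2017, Theorem 4.9, case `d = 1`; Edmonds 1965)

Braun–Brown-Cohen–Huq–Pokutta–Raghavendra–Roy–Weitz–Zink, *The matching problem has no small
symmetric SDP*, Math. Program. 165 (2017), proof of Theorem 4.9: "The case `d = 1` rephrased means
that the affine space spanned by the characteristic vectors of all perfect matchings is defined by
the `Σ_v x_{uv} - 1` for all vertices `u`. This follows from Edmonds's description of the perfect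
matching polytope by linear inequalities."  We prove this degree-one case directly
(`hasDerivationOfDegree_one_of_totalDegree_le_one`): for even `n`, every polynomial `F` of total
degree `≤ 1` in the edge variables of `K_n` that vanishes at `χ^M` for every perfect matching `M`
is a constant linear combination of the vertex equations of `𝒫_n = Mod2.system n`, i.e. derivable
from `𝒫_n` in degree `1` (`HasDerivationOfDegree`, `MatchingDerivations.lean`).

Proof (elementary, in place of Edmonds' theorem): comparing the two perfect matchings
`M₀ ∪ {uv, wz}` and `M₀ ∪ {uw, vz}` gives the 2-SWITCH RELATIONS `a_{uv} + a_{wz} = a_{uw} + a_{vz}`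
for the linear coefficients `a` of `F` (`switch_rel`); these force `a_{xy} = λ_x + λ_y` for the
explicit potential `λ_x = (a_{xp} + a_{xq} - a_{pq})/2` (`exists_potential`), whence
`F - Σ_u λ_u · (Σ_{e ∋ u} x_e - 1)` is a constant vanishing at a perfect matching, hence `0`.

## References

* G. Braun et al., *The matching problem has no small symmetric SDP*, Math. Program. 165 (2017)
  643–662, Thm. 4.9 (case `d = 1`) (arXiv:1504.00703, p. 9). [BraunEtAl2016]
* J. Edmonds, *Maximum matching and a polyhedron with 0,1-vertices*, J. Res. Nat. Bur. Standards
  69B (1965) 125–130. [Edmonds1965]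
-/

noncomputable section

open MvPolynomial Finset
open Literature.Barriers.PneNP (IsPMOn exists_isPMOn_of_even)

namespace Literature.Computability.Complexity

namespace Mod2

variable {n : ℕ}

/-! ### Linear polynomials in the edge variables -/

/-- The linear coefficient `a_e` of `F` at the edge variable `x_e`.
[cite: BraunEtAl2016, Thm. 4.9 (case d = 1)] -/
def linCoeff (F : MvPolynomial (KnEdge n) ℝ) (e : KnEdge n) : ℝ := coeff (Finsupp.single e 1) F

/-- An exponent vector of degree `≤ 1` is `0` or a single variable. [cite: BraunEtAl2016, Thm. 4.9 (case d = 1)] -/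
theorem eq_zero_or_single_of_degree_le_one {σ : Type*} (α : σ →₀ ℕ) (h : (α.sum fun _ k => k) ≤ 1) :
    α = 0 ∨ ∃ e, α = Finsupp.single e 1 := by
  classical
  by_cases h0 : α = 0
  · exact Or.inl h0
  · right
    obtain ⟨e, he⟩ : α.support.Nonempty := Finsupp.support_nonempty_iff.2 h0
    have hαe : 1 ≤ α e := Nat.one_le_iff_ne_zero.2 (Finsupp.mem_support_iff.1 he)
    have hle : α e ≤ α.sum fun _ k => k := by
      rw [Finsupp.sum]
      exact Finset.single_le_sum (fun _ _ => Nat.zero_le _) he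
    refine ⟨e, Finsupp.eq_single_iff.2 ⟨fun f hf => ?_, by omega⟩⟩
    rw [mem_singleton]
    by_contra hfe
    have hαf : 1 ≤ α f := Nat.one_le_iff_ne_zero.2 (Finsupp.mem_support_iff.1 hf)
    have h2 : α e + α f ≤ α.sum fun _ k => k := by
      rw [Finsupp.sum, ← Finset.sum_pair (Ne.symm hfe)]
      exact Finset.sum_le_sum_of_subset_of_nonneg
        (by intro x hx; simp only [mem_insert, mem_singleton] at hx; rcases hx with rfl | rfl <;> assumption)
        (fun _ _ _ => Nat.zero_le _)
    omega

/-- **Linear normal form**: a polynomial of total degree `≤ 1` is `c + Σ_e a_e x_e` with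
`c` its constant coefficient and `a_e` its linear coefficients. [cite: BraunEtAl2016, Thm. 4.9 (case d = 1)] -/
theorem eq_C_add_sum_of_totalDegree_le_one (F : MvPolynomial (KnEdge n) ℝ) (hF : F.totalDegree ≤ 1) :
    F = C (coeff 0 F) + ∑ e, C (linCoeff F e) * X e := by
  classical
  apply MvPolynomial.ext
  intro α
  simp_rw [C_mul_X_eq_monomial, coeff_add, coeff_C, coeff_sum, coeff_monomial]
  have hs0 : ∀ e : KnEdge n, Finsupp.single e 1 ≠ (0 : KnEdge n →₀ ℕ) := fun e =>
    Finsupp.single_ne_zero.2 one_ne_zero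
  by_cases hα : (α.sum fun _ k => k) ≤ 1
  · rcases eq_zero_or_single_of_degree_le_one α hα with rfl | ⟨e, rfl⟩
    · rw [if_pos rfl, Finset.sum_eq_zero fun e _ => if_neg (hs0 e), add_zero]
    · rw [if_neg (hs0 e).symm, zero_add,
        Finset.sum_eq_single e (fun f _ hfe => if_neg fun h =>
          hfe (Finsupp.single_left_injective one_ne_zero h)) (fun h => absurd (mem_univ e) h),
        if_pos rfl]
      rfl
  · -- `α` of degree `≥ 2`: both sides vanish
    have hcoeff : coeff α F = 0 := by
      by_contra h
      exact hα ((le_totalDegree (mem_support_iff.2 h)).trans hF)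
    rw [hcoeff, if_neg, zero_add, Finset.sum_eq_zero]
    · intro e _
      rw [if_neg]
      rintro rfl
      apply hα
      rw [Finsupp.sum_single_index rfl]
    · rintro rfl
      exact hα (by simp)

/-- **Evaluation of a linear polynomial at a perfect matching** (indeed at any loop-free edge
set): `F(χ^M) = c + Σ_{s ∈ M} a_s`. [cite: BraunEtAl2016, Thm. 4.9 (case d = 1)] -/
theorem eval_edgeIndicator_of_totalDegree_le_one (F : MvPolynomial (KnEdge n) ℝ)
    (hF : F.totalDegree ≤ 1) {M : Finset (Sym2 (Fin n))} (hM : ∀ s ∈ M, ¬ s.IsDiag) :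
    eval (edgeIndicator M) F =
      coeff 0 F + ∑ s ∈ M.attach, linCoeff F ⟨s.1, hM s.1 s.2⟩ := by
  classical
  conv_lhs => rw [eq_C_add_sum_of_totalDegree_le_one F hF]
  rw [map_add, eval_C, map_sum]
  simp_rw [map_mul, eval_C, eval_X, edgeIndicator_apply, mul_ite, mul_one, mul_zero]
  congr 1
  rw [← Finset.sum_filter]
  refine Finset.sum_bij' (fun e he => (⟨(e : Sym2 (Fin n)), (mem_filter.1 he).2⟩ : {s // s ∈ M}))
    (fun s _ => (⟨s.1, hM s.1 s.2⟩ : KnEdge n)) ?_ ?_ ?_ ?_ ?_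
  · intro e _; exact mem_attach _ _
  · intro s _; exact mem_filter.2 ⟨mem_univ _, s.2⟩
  · intro e _; rfl
  · intro s _; rfl
  · intro e _; rfl

/-! ### The 2-switch relations -/

/-- For four distinct vertices of `K_n`, `n` even, there is a perfect matching of the other
`n - 4` vertices. [cite: BraunEtAl2016, Thm. 4.9 (case d = 1)] -/
theorem exists_isPMOn_compl_four (hn : Even n) {u v w z : Fin n} (huv : u ≠ v) (huw : u ≠ w)
    (huz : u ≠ z) (hvw : v ≠ w) (hvz : v ≠ z) (hwz : w ≠ z) :
    ∃ M₀ : Finset (Sym2 (Fin n)), IsPMOn (univ \ {u, v, w, z}) M₀ := by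
  have hcard : (univ \ ({u, v, w, z} : Finset (Fin n))).card = n - 4 := by
    rw [card_sdiff_of_subset (subset_univ _), card_univ, Fintype.card_fin,
      card_insert_of_notMem (by simp [huv, huw, huz]), card_insert_of_notMem (by simp [hvw, hvz]),
      card_pair hwz]
  have heven : Even (n - 4) := by
    obtain ⟨k, hk⟩ := hn
    exact ⟨k - 2, by omega⟩
  exact exists_isPMOn_of_even _ _ hcard heven

/-- Adding two disjoint edges on the four missing vertices to a perfect matching of the rest gives
a perfect matching of `K_n`. [cite: BraunEtAl2016, Thm. 4.9 (case d = 1)] -/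
theorem isPMOn_insert_insert {u v w z : Fin n} (huv : u ≠ v) (huw : u ≠ w) (huz : u ≠ z)
    (hvw : v ≠ w) (hvz : v ≠ z) (hwz : w ≠ z) {M₀ : Finset (Sym2 (Fin n))}
    (hM₀ : IsPMOn (univ \ {u, v, w, z}) M₀) :
    IsPMOn univ (insert s(u, v) (insert s(w, z) M₀)) := by
  classical
  have h1 : IsPMOn ({u, v} : Finset (Fin n)) {s(u, v)} := IsPMOn.pair huv
  have h2 : IsPMOn ({w, z} : Finset (Fin n)) {s(w, z)} := IsPMOn.pair hwz
  have h12 : IsPMOn ({u, v} ∪ {w, z} : Finset (Fin n)) ({s(u, v)} ∪ {s(w, z)}) :=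
    h1.union h2 (by
      rw [Finset.disjoint_insert_left, Finset.disjoint_singleton_left]
      simp only [mem_insert, mem_singleton, not_or]
      exact ⟨⟨huw, huz⟩, hvw, hvz⟩)
  have hall : IsPMOn (({u, v} ∪ {w, z}) ∪ (univ \ {u, v, w, z}) : Finset (Fin n))
      (({s(u, v)} ∪ {s(w, z)}) ∪ M₀) :=
    h12.union hM₀ (by
      rw [Finset.disjoint_left]
      intro x hx hx'
      rw [mem_sdiff] at hx'
      apply hx'.2
      simp only [mem_union, mem_insert, mem_singleton] at hx ⊢
      tauto)
  have huniv : (({u, v} ∪ {w, z}) ∪ (univ \ {u, v, w, z}) : Finset (Fin n)) = univ := by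
    ext x
    simp only [mem_union, mem_insert, mem_singleton, mem_sdiff, mem_univ, true_and, iff_true]
    tauto
  have hset : (({s(u, v)} ∪ {s(w, z)}) ∪ M₀ : Finset (Sym2 (Fin n))) =
      insert s(u, v) (insert s(w, z) M₀) := by
    ext s
    simp only [mem_union, mem_singleton, mem_insert]
    tauto
  rw [huniv, hset] at hall
  exact hall

/-- **The 2-switch relation.** If `F` is linear and vanishes on all perfect matchings of `K_n`
(`n` even) then for distinct `u, v, w, z`: `a_{uv} + a_{wz} = a_{uw} + a_{vz}`.
[cite: BraunEtAl2016, Thm. 4.9 (case d = 1, "the affine space spanned by the characteristic vectors of all perfect matchings")] -/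
theorem switch_rel (hn : Even n) {F : MvPolynomial (KnEdge n) ℝ} (hF : F.totalDegree ≤ 1)
    (hF0 : ∀ M : Finset (Sym2 (Fin n)), IsPMOn univ M → eval (edgeIndicator M) F = 0)
    {u v w z : Fin n} (huv : u ≠ v) (huw : u ≠ w) (huz : u ≠ z) (hvw : v ≠ w) (hvz : v ≠ z)
    (hwz : w ≠ z) :
    linCoeff F ⟨s(u, v), by rw [Sym2.mk_isDiag_iff]; exact huv⟩ +
      linCoeff F ⟨s(w, z), by rw [Sym2.mk_isDiag_iff]; exact hwz⟩ =
    linCoeff F ⟨s(u, w), by rw [Sym2.mk_isDiag_iff]; exact huw⟩ +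
      linCoeff F ⟨s(v, z), by rw [Sym2.mk_isDiag_iff]; exact hvz⟩ := by
  classical
  obtain ⟨M₀, hM₀⟩ := exists_isPMOn_compl_four hn huv huw huz hvw hvz hwz
  have hM₁ := isPMOn_insert_insert huv huw huz hvw hvz hwz hM₀
  have hM₀' : IsPMOn (univ \ {u, w, v, z}) M₀ := by
    have : ({u, w, v, z} : Finset (Fin n)) = {u, v, w, z} := by
      ext x; simp only [mem_insert, mem_singleton]; tauto
    rw [this]; exact hM₀
  have hM₂ := isPMOn_insert_insert huw huv huz hvw.symm hwz hvz hM₀'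
  -- the new edges are not in `M₀` and are distinct
  have hnot : ∀ {x y : Fin n}, x ∈ ({u, v, w, z} : Finset (Fin n)) → s(x, y) ∉ M₀ := by
    intro x y hx hs
    have := hM₀.mem_of_mem hs (Sym2.mem_mk_left x y)
    rw [mem_sdiff] at this
    exact this.2 hx
  have huvM : s(u, v) ∉ insert s(w, z) M₀ := by
    rw [mem_insert, not_or]
    refine ⟨fun h => ?_, hnot (by simp)⟩
    have := Sym2.eq_iff.1 h; rcases this with ⟨rfl, -⟩ | ⟨rfl, -⟩ <;> tauto
  have hwzM : s(w, z) ∉ M₀ := hnot (by simp)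
  have huwM : s(u, w) ∉ insert s(v, z) M₀ := by
    rw [mem_insert, not_or]
    refine ⟨fun h => ?_, hnot (by simp)⟩
    have := Sym2.eq_iff.1 h; rcases this with ⟨rfl, -⟩ | ⟨rfl, -⟩ <;> tauto
  have hvzM : s(v, z) ∉ M₀ := hnot (by simp)
  -- evaluate `F` at both matchings
  have e1 := hF0 _ hM₁
  have e2 := hF0 _ hM₂
  rw [eval_edgeIndicator_of_totalDegree_le_one F hF hM₁.2.1] at e1
  rw [eval_edgeIndicator_of_totalDegree_le_one F hF hM₂.2.1] at e2
  -- expand the attached sums: `Σ_{attach (insert x N)} g = g x + Σ_{attach N} g`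
  have key : ∀ (N : Finset (Sym2 (Fin n))) (hN : ∀ s ∈ N, ¬ s.IsDiag),
      ∑ s ∈ N.attach, linCoeff F ⟨s.1, hN s.1 s.2⟩ =
        ∑ s ∈ N, if h : ¬ s.IsDiag then linCoeff F ⟨s, h⟩ else 0 := by
    intro N hN
    conv_rhs => rw [← Finset.sum_attach]
    exact Finset.sum_congr rfl fun s _ => by rw [dif_pos (hN s.1 s.2)]
  rw [key] at e1 e2
  rw [Finset.sum_insert huvM, Finset.sum_insert hwzM] at e1
  rw [Finset.sum_insert huwM, Finset.sum_insert hvzM] at e2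
  rw [dif_pos (by rw [Sym2.mk_isDiag_iff]; exact huv), dif_pos (by rw [Sym2.mk_isDiag_iff]; exact hwz)] at e1
  rw [dif_pos (by rw [Sym2.mk_isDiag_iff]; exact huw), dif_pos (by rw [Sym2.mk_isDiag_iff]; exact hvz)] at e2
  linarith

/-! ### Potentials -/

/-- The linear coefficient as a function of an unordered pair of DISTINCT vertices (junk `0` on
loops). [cite: BraunEtAl2016, Thm. 4.9 (case d = 1)] -/
def pairCoeff (F : MvPolynomial (KnEdge n) ℝ) (s : Sym2 (Fin n)) : ℝ :=
  if h : ¬ s.IsDiag then linCoeff F ⟨s, h⟩ else 0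

/-- On an edge, `pairCoeff` is the linear coefficient. [cite: BraunEtAl2016, Thm. 4.9 (case d = 1)] -/
theorem pairCoeff_eq (F : MvPolynomial (KnEdge n) ℝ) (e : KnEdge n) :
    pairCoeff F (e : Sym2 (Fin n)) = linCoeff F e := by
  rw [pairCoeff, dif_pos e.2]

/-- The switch relation for `pairCoeff`. [cite: BraunEtAl2016, Thm. 4.9 (case d = 1)] -/
theorem switch_rel' (hn : Even n) {F : MvPolynomial (KnEdge n) ℝ} (hF : F.totalDegree ≤ 1)
    (hF0 : ∀ M : Finset (Sym2 (Fin n)), IsPMOn univ M → eval (edgeIndicator M) F = 0)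
    {u v w z : Fin n} (huv : u ≠ v) (huw : u ≠ w) (huz : u ≠ z) (hvw : v ≠ w) (hvz : v ≠ z)
    (hwz : w ≠ z) :
    pairCoeff F s(u, v) + pairCoeff F s(w, z) = pairCoeff F s(u, w) + pairCoeff F s(v, z) := by
  simp only [pairCoeff, dif_pos (show ¬ (s(u, v)).IsDiag by rw [Sym2.mk_isDiag_iff]; exact huv),
    dif_pos (show ¬ (s(w, z)).IsDiag by rw [Sym2.mk_isDiag_iff]; exact hwz),
    dif_pos (show ¬ (s(u, w)).IsDiag by rw [Sym2.mk_isDiag_iff]; exact huw),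
    dif_pos (show ¬ (s(v, z)).IsDiag by rw [Sym2.mk_isDiag_iff]; exact hvz)]
  exact switch_rel hn hF hF0 huv huw huz hvw hvz hwz

/-- **Existence of a potential** (`n ≥ 4` even): the switch relations force
`a_{xy} = λ_x + λ_y` with `λ_x = (a_{xp} + a_{xq} - a_{pq})/2` off `{p, q}` (suitably adjusted at
`p, q`). [cite: BraunEtAl2016, Thm. 4.9 (case d = 1)] -/
theorem exists_potential (hn : Even n) (h4 : 4 ≤ n) {F : MvPolynomial (KnEdge n) ℝ}
    (hF : F.totalDegree ≤ 1)
    (hF0 : ∀ M : Finset (Sym2 (Fin n)), IsPMOn univ M → eval (edgeIndicator M) F = 0) :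
    ∃ lam : Fin n → ℝ, ∀ x y : Fin n, x ≠ y → pairCoeff F s(x, y) = lam x + lam y := by
  -- three distinct reference vertices
  set p : Fin n := ⟨0, by omega⟩
  set q : Fin n := ⟨1, by omega⟩
  set r : Fin n := ⟨2, by omega⟩
  have hpq : p ≠ q := by simp [p, q, Fin.ext_iff]
  have hpr : p ≠ r := by simp [p, r, Fin.ext_iff]
  have hqr : q ≠ r := by simp [q, r, Fin.ext_iff]
  set b := pairCoeff F with hb
  have bsymm : ∀ x y, b s(x, y) = b s(y, x) := fun x y => by rw [Sym2.eq_swap]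
  have sw : ∀ {u v w z : Fin n}, u ≠ v → u ≠ w → u ≠ z → v ≠ w → v ≠ z → w ≠ z →
      b s(u, v) + b s(w, z) = b s(u, w) + b s(v, z) :=
    fun huv huw huz hvw hvz hwz => switch_rel' hn hF hF0 huv huw huz hvw hvz hwz
  set A := (b s(p, q) + b s(p, r) - b s(q, r)) / 2 with hA
  set B := (b s(p, q) + b s(q, r) - b s(p, r)) / 2 with hB
  set L : Fin n → ℝ := fun x => if x = p then A else if x = q then B
    else (b s(x, p) + b s(x, q) - b s(p, q)) / 2 with hL
  have Lp : L p = A := by simp [hL]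
  have Lq : L q = B := by simp [hL, hpq.symm]
  have Lo : ∀ x, x ≠ p → x ≠ q → L x = (b s(x, p) + b s(x, q) - b s(p, q)) / 2 := by
    intro x hxp hxq; simp [hL, hxp, hxq]
  refine ⟨L, fun x y hxy => ?_⟩
  rcases eq_or_ne x p with hxp | hxp
  · rw [hxp] at hxy ⊢
    rw [Lp]
    rcases eq_or_ne y q with hyq | hyq
    · rw [hyq, Lq, hA, hB]; ring
    · rw [Lo y hxy.symm hyq]
      rcases eq_or_ne y r with hyr | hyr
      · rw [hyr, hA]
        have h1 := bsymm r p; have h2 := bsymm r q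
        linarith
      · have h := sw hpr hxy hpq hyr.symm hqr.symm hyq   -- (p, r, y, q)
        have h1 := bsymm y p; have h2 := bsymm r q
        rw [hA]; linarith
  · rcases eq_or_ne x q with hxq | hxq
    · rw [hxq] at hxy ⊢
      rw [Lq]
      rcases eq_or_ne y p with hyp | hyp
      · rw [hyp, Lp, hA, hB]
        have := bsymm q p
        linarith
      · rw [Lo y hyp hxy.symm]
        rcases eq_or_ne y r with hyr | hyr
        · rw [hyr, hB]
          have h1 := bsymm r p; have h2 := bsymm r q
          linarith
        · have h := sw hqr hxy hpq.symm hyr.symm hpr.symm hyp   -- (q, r, y, p)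
          have h1 := bsymm r p; have h2 := bsymm y q
          rw [hB]; linarith
    · rw [Lo x hxp hxq]
      rcases eq_or_ne y p with hyp | hyp
      · rw [hyp, Lp, hA]
        rcases eq_or_ne x r with hxr | hxr
        · rw [hxr]
          have h1 := bsymm r p; have h2 := bsymm r q
          linarith
        · have h := sw hpr (Ne.symm hxp) hpq hxr.symm hqr.symm hxq   -- (p, r, x, q)
          have h1 := bsymm p x; have h2 := bsymm r q
          linarith
      · rcases eq_or_ne y q with hyq | hyq
        · rw [hyq, Lq, hB]
          rcases eq_or_ne x r with hxr | hxr
          · rw [hxr]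
            have h1 := bsymm r q; have h2 := bsymm r p
            linarith
          · have h := sw hqr (Ne.symm hxq) hpq.symm hxr.symm hpr.symm hxp   -- (q, r, x, p)
            have h1 := bsymm q x; have h2 := bsymm r p
            linarith
        · rw [Lo y hyp hyq]
          have h₁ := sw hxp hxy hxq (Ne.symm hyp) hpq hyq        -- (x, p, y, q)
          have h₂ := sw hxq hxy hxp (Ne.symm hyq) hpq.symm hyp   -- (x, q, y, p)
          have h1 := bsymm q p; have h2 := bsymm y p; have h3 := bsymm y q
          linarith

/-- Potentials exist for every even `n` (for `n ≤ 2` there is at most one edge).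
[cite: BraunEtAl2016, Thm. 4.9 (case d = 1)] -/
theorem exists_potential' (hn : Even n) {F : MvPolynomial (KnEdge n) ℝ} (hF : F.totalDegree ≤ 1)
    (hF0 : ∀ M : Finset (Sym2 (Fin n)), IsPMOn univ M → eval (edgeIndicator M) F = 0) :
    ∃ lam : Fin n → ℝ, ∀ x y : Fin n, x ≠ y → pairCoeff F s(x, y) = lam x + lam y := by
  by_cases h4 : 4 ≤ n
  · exact exists_potential hn h4 hF hF0
  · -- `n ∈ {0, 2}`: all pairs of distinct vertices coincide
    have hn2 : n ≤ 2 := by obtain ⟨k, hk⟩ := hn; omega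
    by_cases hne : ∃ x y : Fin n, x ≠ y
    · obtain ⟨x₀, y₀, hxy₀⟩ := hne
      refine ⟨fun _ => pairCoeff F s(x₀, y₀) / 2, fun x y hxy => ?_⟩
      have key : ∀ z : Fin n, z = x₀ ∨ z = y₀ := by
        intro z
        by_contra h
        push Not at h
        have : ({x₀, y₀, z} : Finset (Fin n)).card ≤ n := by
          simpa using Finset.card_le_univ ({x₀, y₀, z} : Finset (Fin n))
        rw [card_insert_of_notMem (by simp [hxy₀, Ne.symm h.1]),
          card_pair (Ne.symm h.2)] at this
        omega
      have hs : s(x, y) = s(x₀, y₀) := by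
        rcases key x with rfl | rfl <;> rcases key y with rfl | rfl
        · exact absurd rfl hxy
        · rfl
        · exact Sym2.eq_swap
        · exact absurd rfl hxy
      rw [hs]; ring
    · refine ⟨fun _ => 0, fun x y hxy => (hne ⟨x, y, hxy⟩).elim⟩

/-! ### Degree-one derivations -/

/-- The vertices lying on the edge `e = {x, y}` are `x` and `y`. [cite: BraunEtAl2016, §4.2 (p. 7, the vertex equations)] -/
theorem filter_mem_edge_eq (x y : Fin n) :
    (univ.filter fun u : Fin n => u ∈ (s(x, y) : Sym2 (Fin n))) = {x, y} := by
  ext u; simp [Sym2.mem_iff]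

/-- A vertex equation has total degree `≤ 1`. [cite: BraunEtAl2016, §4.2 (p. 7)] -/
theorem totalDegree_system_vertex_le (i : Fin n) :
    (system n (Sum.inr (Sum.inr i))).totalDegree ≤ 1 := by
  rw [system_vertex]
  refine (totalDegree_sub _ _).trans (max_le ?_ (by simp))
  exact (totalDegree_finsetSum _ _).trans (Finset.sup_le fun e _ => (totalDegree_X e).le)

/-- **The affine hull of `PM(K_n)` (BBCHPRRWZ Thm 4.9, case `d = 1`; Edmonds): every linear
polynomial vanishing on the perfect matchings of `K_n` (`n` even) is a constant linear combination
of the vertex equations.** This is the cell's typed `PMAffineHull` (HOME/pnp-psdrank-p2/Sketch-v2.lean),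
verbatim. [cite: BraunEtAl2016, Thm. 4.9 (case d = 1)] -/
theorem exists_eq_sum_C_mul_vertex (hn : Even n)
    (F : MvPolynomial (KnEdge n) ℝ) (hF : F.totalDegree ≤ 1)
    (hF0 : ∀ M : Finset (Sym2 (Fin n)), IsPMOn univ M → eval (edgeIndicator M) F = 0) :
    ∃ π : Fin n → ℝ, F = ∑ v, C (π v) * system n (Sum.inr (Sum.inr v)) := by
  classical
  obtain ⟨lam, hlam⟩ := exists_potential' hn hF hF0
  -- the linear coefficients are the edge sums of the potential
  have hcoeff : ∀ e : KnEdge n,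
      (∑ u ∈ univ.filter (fun u : Fin n => u ∈ (e : Sym2 (Fin n))), lam u) = linCoeff F e := by
    rintro ⟨e, he⟩
    induction e using Sym2.ind with
    | _ x y =>
      have hxy : x ≠ y := by rwa [Sym2.mk_isDiag_iff] at he
      rw [← pairCoeff_eq]
      change (∑ u ∈ univ.filter (fun u : Fin n => u ∈ (s(x, y) : Sym2 (Fin n))), lam u) =
        pairCoeff F s(x, y)
      rw [filter_mem_edge_eq, sum_pair hxy, hlam x y hxy]
  -- `Σ_u λ_u (Σ_{e ∋ u} x_e) = Σ_e a_e x_e`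
  have hlin : ∑ u : Fin n, C (lam u) * (∑ e ∈ univ.filter (fun e : KnEdge n => u ∈ (e : Sym2 (Fin n))), X e) =
      ∑ e, C (linCoeff F e) * X e := by
    calc ∑ u : Fin n, C (lam u) * (∑ e ∈ univ.filter (fun e : KnEdge n => u ∈ (e : Sym2 (Fin n))), X e)
        = ∑ u : Fin n, ∑ e : KnEdge n, (if u ∈ (e : Sym2 (Fin n)) then C (lam u) * X e else 0) := by
          refine sum_congr rfl fun u _ => ?_
          rw [mul_sum, sum_filter]
      _ = ∑ e : KnEdge n, ∑ u : Fin n, (if u ∈ (e : Sym2 (Fin n)) then C (lam u) * X e else 0) :=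
          sum_comm
      _ = ∑ e : KnEdge n,
            (∑ u ∈ univ.filter (fun u : Fin n => u ∈ (e : Sym2 (Fin n))), C (lam u)) * X e := by
          refine sum_congr rfl fun e _ => ?_
          rw [sum_filter, sum_mul]
          refine sum_congr rfl fun u _ => ?_
          split_ifs <;> simp
      _ = ∑ e, C (linCoeff F e) * X e := by
          refine sum_congr rfl fun e _ => ?_
          rw [← map_sum, hcoeff e]
  -- `Σ_v λ_v S_v = Σ_e a_e x_e - Σ_v λ_v`
  have hsum : ∑ v, C (lam v) * system n (Sum.inr (Sum.inr v)) =
      (∑ e, C (linCoeff F e) * X e) - C (∑ u, lam u) := by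
    simp only [system_vertex, mul_sub, mul_one, sum_sub_distrib, map_sum]
    rw [hlin]
  -- the leftover constant vanishes at a perfect matching
  obtain ⟨M, hM⟩ := exists_isPMOn_of_even n (univ : Finset (Fin n)) (by simp) hn
  have hconst : coeff 0 F + ∑ u, lam u = 0 := by
    have h1 : eval (edgeIndicator M) (∑ v, C (lam v) * system n (Sum.inr (Sum.inr v))) = 0 := by
      rw [map_sum]
      exact sum_eq_zero fun v _ => by rw [map_mul, eval_system_edgeIndicator hM, mul_zero]
    have h2 := hF0 M hM
    rw [eq_C_add_sum_of_totalDegree_le_one F hF] at h2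
    rw [hsum, map_sub, eval_C] at h1
    rw [map_add, eval_C] at h2
    linarith
  refine ⟨lam, ?_⟩
  rw [hsum]
  conv_lhs => rw [eq_C_add_sum_of_totalDegree_le_one F hF]
  have : coeff 0 F = -∑ u, lam u := by linarith
  rw [this, map_neg]
  ring

/-- **BBCHPRRWZ Theorem 4.9, case `d = 1`**: every linear polynomial vanishing on the perfect
matchings of `K_n` (`n` even) is derivable from `𝒫_n` in degree `1`.
[cite: BraunEtAl2016, Thm. 4.9 (case d = 1)] -/
theorem hasDerivationOfDegree_one_of_totalDegree_le_one (hn : Even n)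
    (F : MvPolynomial (KnEdge n) ℝ) (hF : F.totalDegree ≤ 1)
    (hF0 : ∀ M : Finset (Sym2 (Fin n)), IsPMOn univ M → eval (edgeIndicator M) F = 0) :
    HasDerivationOfDegree (system n) F 1 := by
  classical
  obtain ⟨π, hπ⟩ := exists_eq_sum_C_mul_vertex hn F hF hF0
  let g : Idx n → MvPolynomial (KnEdge n) ℝ := fun ι =>
    match ι with
    | Sum.inr (Sum.inr u) => C (π u)
    | _ => 0
  have hg_edge : ∀ e : KnEdge n, g (Sum.inl e) = 0 := fun _ => rfl
  have hg_pair : ∀ pr, g (Sum.inr (Sum.inl pr)) = 0 := fun _ => rfl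
  have hg_vert : ∀ u, g (Sum.inr (Sum.inr u)) = C (π u) := fun _ => rfl
  refine ⟨g, ?_, ?_⟩
  · rintro (e | pr | u)
    · rw [hg_edge e, zero_mul, totalDegree_zero]; exact Nat.zero_le _
    · rw [hg_pair pr, zero_mul, totalDegree_zero]; exact Nat.zero_le _
    · rw [hg_vert u]
      exact (totalDegree_mul _ _).trans (by rw [totalDegree_C, zero_add]; exact totalDegree_system_vertex_le u)
  · rw [Fintype.sum_sum_type, Fintype.sum_sum_type]
    simp only [hg_edge, hg_pair, zero_mul, sum_const_zero, zero_add, hg_vert]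
    exact hπ.symm

end Mod2

end Literature.Computability.Complexity
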